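import Summits.BirchSwinnertonDyer.BirchSwinnertonDyer.Theorems.ManinLocalTwoThreePrimeClassGenerationEdges
import Summits.BirchSwinnertonDyer.BirchSwinnertonDyer.Theorems.ManinLocalTwoThreeShiftSpanOldform
import HarnessLib

/-!
# Route `ManinLocalTwoThree`, crux C2 `ManinOddAtFour` (stmt-BirchSwinnertonDyer-22967), line `kato-shift-two`
# (es g7): the multi-shift span IS the period lattice of the Gen-DEPLETED OLDFORM
# `h₂ = f ∣ ∏_{t ∈ Gen(N)} (1 − ι_t) = Σ_{T ⊆ Gen(N)} (−1)^{|T|} (∏T)·f((∏T)τ)` on `Γ₀(8N²)`; hence E-es-22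
# `MultiShiftClassGenerationTwo` is EQUIVALENT to: an odd multiple of `Λ_f` lies in `Λ_{h₂}` — an Ihara-type statement
# for the degeneracy maps at the primes `2 ∣ N` and `q ∥ N` (line prover p3; helper, unconditional)

For `f ∈ S₂(Γ₀(N))`, `4 ∣ N`, `Gen(N) = {8} ∪ {q ∥ N}`, put
`h₂ := Σ_{T ⊆ Gen(N)} (−1)^{|T|} · degeneracyMap0 N (8N²) (∏_{t∈T} t) 2 f ∈ S₂(Γ₀(8N²))` (the tree's degeneracy maps
`ι_e : f ↦ f ∣₂ diag(e,1) = e·f(eτ)`, `coe_degeneracyMap0`; `N·∏T ∣ 8N²`; the level `8N²` has the same prime support as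
`N·∏_{t ∈ Gen} t`, so the same second columns). Then
* `modularSymbol_multiShiftOldform` — `{∞, r}_{h₂} = Σ_T (−1)^{|T|} {∞, (∏T)·r}_f`;
* `cuspSymbol_multiShiftOldform` — `{∞, γ∞}_{h₂} = Σ_T (−1)^{|T|} ({∞, b∏T/d}_f − {∞, 0}_f)` for `γ = (· b; · d) ∈ Γ₀(8N²)`:
  the periods of `h₂` ARE the column elements of `…MultiShiftSpanColumns`;
* `periodLattice_multiShiftOldform_eq_closure_columns` — `Λ_{h₂}` = the column span;
* `multiShiftSpan_admissible_eq_periodLattice_oldform` — for every `ℓ₀`, the span of E-es-22's multi-shift classes over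
  admissible `ℓ ≥ ℓ₀` EQUALS `Λ_{h₂}` (no index loss at `p = 2`);
* `multiShiftClassGenerationTwo_iff_oldformLattice` — **E-es-22 ⟺ for every `W`-newform `f` with `4 ∣ N` and `W[2]`
  irreducible some ODD `m` has `m·Λ_f ⊆ Λ_{h₂}`**: the auxiliary primes, the holes and `ℓ₀` are gone; what is left is the
  image of `Σ_T (−1)^{|T|} (π_{∏T})_*` on integral homology `H₁(X₀(8N²), ℤ) → H₁(X₀(N), ℤ)` at primes DIVIDING the level.
(Technical: the summand is written `degeneracyMap0 N (8N²) (∏_{t∈T} t − 1 + 1) 2 f` so that the instance `NeZero` is found;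
`∏_{t∈T} t − 1 + 1 = ∏_{t∈T} t`.)  Nothing about BSD, Manin's conjecture or E-es-22 itself is proved here.
-/

set_option autoImplicit false
set_option linter.dupNamespace false

noncomputable section

open scoped Classical MatrixGroups ModularForm BigOperators

open CongruenceSubgroup Matrix.SpecialLinearGroup ModularGroup
  Literature.NumberTheory.EllipticCurves Literature.NumberTheory.EllipticCurves.ModularForms
  Summit.BirchSwinnertonDyer.Rank1Residual.ManinAdditive

namespace Summit.BirchSwinnertonDyer.BirchSwinnertonDyer.Theorems.ManinLocalTwoThree

section MultiOldform

variable {N : ℕ} [NeZero N] (f : CuspForm (Gamma0 N) 2)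

/-- Modular symbols are linear in the form: `{∞, r}_{Σ cᵢ gᵢ} = Σ cᵢ {∞, r}_{gᵢ}`. [folklore] -/
theorem modularSymbol_sum_smul {M : ℕ} [NeZero M] {ι : Type*} (s : Finset ι) (c : ι → ℂ)
    (g : ι → CuspForm (Gamma0 M) 2) (r : ℚ) :
    modularSymbol (∑ i ∈ s, c i • g i) r = ∑ i ∈ s, c i * modularSymbol (g i) r := by
  induction s using Finset.induction_on with
  | empty => simp [modularSymbol]
  | insert i s hi ih => rw [Finset.sum_insert hi, Finset.sum_insert hi, modularSymbol_add, modularSymbol_const_smul, ih]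

omit [NeZero N] in
/-- The elements of `Gen(N) = {8} ∪ {q ∥ N}` divide `8N`, are nonzero, and a sub-product `∏_{t ∈ T} t` (`T ⊆ Gen(N)`)
divides `8N`. [folklore] -/
theorem prod_dvd_eight_mul_of_subset_gen {T : Finset ℕ}
    (hT : T ⊆ insert 8 (N.primeFactors.filter fun q => ¬ q ^ 2 ∣ N)) : ∏ t ∈ T, t ∣ 8 * N := by
  -- split off `8`
  have h8 : ∏ t ∈ T, t ∣ 8 * ∏ t ∈ T.erase 8, t := by
    by_cases h : 8 ∈ T
    · have e := Finset.mul_prod_erase T (fun t => t) h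
      rw [← e]
    · rw [Finset.erase_eq_of_notMem h]
      exact dvd_mul_left _ _
  refine dvd_trans h8 (mul_dvd_mul_left 8 ?_)
  refine Finset.prod_primes_dvd N ?_ ?_
  · intro t ht
    have ht' := hT (Finset.mem_of_mem_erase ht)
    rcases Finset.mem_insert.mp ht' with h | h
    · exact absurd h (Finset.ne_of_mem_erase ht)
    · exact (Nat.prime_of_mem_primeFactors (Finset.mem_filter.mp h).1).prime
  · intro t ht
    have ht' := hT (Finset.mem_of_mem_erase ht)
    rcases Finset.mem_insert.mp ht' with h | h
    · exact absurd h (Finset.ne_of_mem_erase ht)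
    · exact Nat.dvd_of_mem_primeFactors (Finset.mem_filter.mp h).1

omit [NeZero N] in
/-- `1 ≤ ∏_{t ∈ T} t` for `T ⊆ Gen(N)`, so `∏_{t∈T} t − 1 + 1 = ∏_{t∈T} t`. [folklore] -/
theorem prod_sub_one_add_one_of_subset_gen {T : Finset ℕ}
    (hT : T ⊆ insert 8 (N.primeFactors.filter fun q => ¬ q ^ 2 ∣ N)) : ∏ t ∈ T, t - 1 + 1 = ∏ t ∈ T, t := by
  refine Nat.sub_add_cancel (Nat.one_le_iff_ne_zero.mpr ?_)
  refine Finset.prod_ne_zero_iff.mpr fun t ht => ?_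
  rcases Finset.mem_insert.mp (hT ht) with rfl | h
  · norm_num
  · exact (Nat.prime_of_mem_primeFactors (Finset.mem_filter.mp h).1).ne_zero

/-- **`{∞, r}_{h₂} = Σ_T (−1)^{|T|} {∞, (∏T)·r}_f`** for the Gen-depleted oldform on `Γ₀(8N²)`
(`coe_degeneracyMap0`, `modularSymbol_slash_tpD`). [cite: CremonaAlgorithms1997, §2.4] -/
theorem modularSymbol_multiShiftOldform (r : ℚ) :
    modularSymbol (∑ T ∈ (insert 8 (N.primeFactors.filter fun q => ¬ q ^ 2 ∣ N)).powerset,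
        (-1 : ℂ) ^ T.card • degeneracyMap0 N (8 * N ^ 2) (∏ t ∈ T, t - 1 + 1) 2 f) r =
      ∑ T ∈ (insert 8 (N.primeFactors.filter fun q => ¬ q ^ 2 ∣ N)).powerset,
        (-1 : ℂ) ^ T.card * modularSymbol f ((∏ t ∈ T, t : ℕ) * r) := by
  rw [modularSymbol_sum_smul]
  refine Finset.sum_congr rfl fun T hT => ?_
  have hTG := Finset.mem_powerset.mp hT
  have hprod := prod_sub_one_add_one_of_subset_gen hTG
  have hdvd : N * (∏ t ∈ T, t - 1 + 1) ∣ 8 * N ^ 2 := by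
    rw [hprod]
    calc N * ∏ t ∈ T, t ∣ N * (8 * N) := mul_dvd_mul_left N (prod_dvd_eight_mul_of_subset_gen hTG)
      _ = 8 * N ^ 2 := by ring
  congr 1
  rw [modularSymbol, coe_degeneracyMap0 N (8 * N ^ 2) (∏ t ∈ T, t - 1 + 1) 2 hdvd f]
  have h := modularSymbol_slash_tpD (∏ t ∈ T, t - 1 + 1) f r
  rw [show ((∏ t ∈ T, t - 1 + 1 : ℕ) : ℚ) = ((∏ t ∈ T, t : ℕ) : ℚ) by exact_mod_cast hprod] at h
  exact h

/-- **The periods of `h₂` are the column elements**: for `γ = (· b; · d) ∈ Γ₀(8N²)`,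
`{∞, γ∞}_{h₂} = Σ_T (−1)^{|T|} ({∞, b∏T/d}_f − {∞, 0}_f)`. [folklore] -/
theorem cuspSymbol_multiShiftOldform (γ : Gamma0 (8 * N ^ 2)) :
    cuspSymbol (∑ T ∈ (insert 8 (N.primeFactors.filter fun q => ¬ q ^ 2 ∣ N)).powerset,
        (-1 : ℂ) ^ T.card • degeneracyMap0 N (8 * N ^ 2) (∏ t ∈ T, t - 1 + 1) 2 f) γ =
      ∑ T ∈ (insert 8 (N.primeFactors.filter fun q => ¬ q ^ 2 ∣ N)).powerset,
        (-1 : ℂ) ^ T.card *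
          (modularSymbol f ((((γ : SL(2, ℤ)) 0 1 * ∏ t ∈ T, (t : ℤ) : ℤ) : ℚ) / (((γ : SL(2, ℤ)) 1 1 : ℤ) : ℚ)) -
            modularSymbol f 0) := by
  have hN0 : 0 < N := Nat.pos_of_ne_zero (NeZero.ne N)
  have hL : 1 < 8 * N ^ 2 := by nlinarith
  have hd := apply_one_one_ne_zero_of_one_lt hL γ
  rw [cuspSymbol_eq_modularSymbol_div_sub _ γ hd, modularSymbol_multiShiftOldform, modularSymbol_multiShiftOldform,
    ← Finset.sum_sub_distrib]
  refine Finset.sum_congr rfl fun T _ => ?_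
  rw [mul_zero, ← mul_sub]
  congr 2
  push_cast
  ring

/-- **`Λ_{h₂}` is the column span** (`4 ∣ N`): the period lattice of the Gen-depleted oldform on `Γ₀(8N²)` is the
subgroup of `ℂ` generated by the column elements `Σ_T (−1)^{|T|} ({∞, b∏T/d}_f − {∞, 0}_f)` over `b d : ℤ`, `d ≠ 0`,
`gcd(d, Nb) = 1` (the second columns of `Γ₀(N)` = those of `Γ₀(8N²)`, `d` being odd). [folklore] -/
theorem periodLattice_multiShiftOldform_eq_closure_columns (h4 : 4 ∣ N) :
    periodLattice (∑ T ∈ (insert 8 (N.primeFactors.filter fun q => ¬ q ^ 2 ∣ N)).powerset,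
        (-1 : ℂ) ^ T.card • degeneracyMap0 N (8 * N ^ 2) (∏ t ∈ T, t - 1 + 1) 2 f) =
      AddSubgroup.closure
        {z : ℂ | ∃ b d : ℤ, d ≠ 0 ∧ IsCoprime d (N * b) ∧
            z = ∑ T ∈ (insert 8 (N.primeFactors.filter fun q => ¬ q ^ 2 ∣ N)).powerset,
                  (-1 : ℂ) ^ T.card *
                    (modularSymbol f (((b * ∏ t ∈ T, (t : ℤ) : ℤ) : ℚ) / d) - modularSymbol f 0)} := by
  have hN0 : 0 < N := Nat.pos_of_ne_zero (NeZero.ne N)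
  have hL : 1 < 8 * N ^ 2 := by nlinarith
  apply le_antisymm
  · rw [periodLattice, AddSubgroup.closure_le]
    rintro _ ⟨γ, rfl⟩
    have hd := apply_one_one_ne_zero_of_one_lt hL γ
    apply AddSubgroup.subset_closure
    refine ⟨((γ : SL(2, ℤ)) 0 1 : ℤ), ((γ : SL(2, ℤ)) 1 1 : ℤ), hd, ?_, ?_⟩
    · have hN' : IsCoprime ((γ : SL(2, ℤ)) 1 1 : ℤ) ((8 * N ^ 2 : ℕ) : ℤ) := isCoprime_apply_one_one_level γ
      push_cast at hN'
      have hN'' : IsCoprime ((γ : SL(2, ℤ)) 1 1 : ℤ) (N : ℤ) :=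
        hN'.of_isCoprime_of_dvd_right ⟨8 * N, by ring⟩
      exact hN''.mul_right (isCoprime_apply_zero_one_apply_one_one γ).symm
    · rw [cuspSymbol_multiShiftOldform f γ]
  · rw [AddSubgroup.closure_le]
    rintro z ⟨b, d, hd0, hcop, rfl⟩
    have hcopN : IsCoprime d (N : ℤ) := hcop.of_mul_right_left
    have hcopb : IsCoprime d b := hcop.of_mul_right_right
    have two_not_unit : ¬ IsUnit (2 : ℤ) := by
      intro h; rcases Int.isUnit_iff.mp h with h | h <;> norm_num at h
    have hdodd : d % 2 = 1 := by
      by_contra h0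
      have h2d : (2 : ℤ) ∣ d := by omega
      have h2N : (2 : ℤ) ∣ (N : ℤ) := dvd_trans (by norm_num) (by exact_mod_cast h4 : (4 : ℤ) ∣ (N : ℤ))
      exact two_not_unit (hcopN.isUnit_of_dvd' h2d h2N)
    have hcop2 : IsCoprime d (2 : ℤ) := ⟨1, -(d / 2), by omega⟩
    have hcop' : IsCoprime d (b * ((8 * N ^ 2 : ℕ) : ℤ)) := by
      push_cast
      exact hcopb.mul_right ((((hcop2.mul_right hcop2).mul_right hcop2).mul_right (hcopN.mul_right hcopN))
        |>.of_isCoprime_of_dvd_right ⟨1, by ring⟩)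
    obtain ⟨γ, h01, h11⟩ := exists_gamma0_entry (N := 8 * N ^ 2) hcop'
    have hz := cuspSymbol_multiShiftOldform f γ
    rw [h01, h11] at hz
    rw [SetLike.mem_coe, ← hz]
    exact cuspSymbol_mem_periodLattice _ γ

/-- **The multi-shift span equals `Λ_{h₂}`** (no index loss): for `4 ∣ N` and every `ℓ₀`, the subgroup generated by
E-es-22's multi-shift classes over admissible primes `ℓ ≥ ℓ₀` is the period lattice of the Gen-depleted oldform `h₂` on
`Γ₀(8N²)` (`multiShiftSpan_admissible_eq_closure_columns` + `periodLattice_multiShiftOldform_eq_closure_columns`).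
[folklore] -/
theorem multiShiftSpan_admissible_eq_periodLattice_oldform (h4 : 2 ^ 2 ∣ N) (ℓ₀ : ℕ) :
    AddSubgroup.closure
      {z : ℂ | ∃ ℓ ∈ {ℓ : ℕ | ℓ₀ ≤ ℓ ∧ (ℓ.Prime ∧ ¬ ℓ ∣ N ∧ ℓ % 4 = 3 ∧
          ∀ t ∈ insert 8 (N.primeFactors.filter fun q => ¬ q ^ 2 ∣ N),
            (t : ZMod ℓ) ≠ 1 ∧ (t : ZMod ℓ) ≠ -1)},
        ∃ a : ℕ, 0 < a ∧ a < ℓ ∧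
          z = ∑ T ∈ (insert 8 (N.primeFactors.filter fun q => ¬ q ^ 2 ∣ N)).powerset,
                (-1 : ℂ) ^ T.card *
                  (modularSymbol f (((a * ∏ t ∈ T, t : ℕ) : ℚ) / ℓ) - modularSymbol f 0)} =
    periodLattice (∑ T ∈ (insert 8 (N.primeFactors.filter fun q => ¬ q ^ 2 ∣ N)).powerset,
        (-1 : ℂ) ^ T.card • degeneracyMap0 N (8 * N ^ 2) (∏ t ∈ T, t - 1 + 1) 2 f) := by
  rw [multiShiftSpan_admissible_eq_closure_columns f h4 ℓ₀,
    periodLattice_multiShiftOldform_eq_closure_columns f (by norm_num at h4; exact h4)]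

/-- **E-es-22 ⟺ an odd multiple of `Λ_f` lies in `Λ_{h₂}`**, `h₂ = Σ_{T ⊆ Gen(N)} (−1)^{|T|} ι_{∏T} f` on `Γ₀(8N²)`.
The multi-shift generation law `MultiShiftClassGenerationTwo` holds iff for every `W`-newform `f` of level `N` with
`4 ∣ N` and `W[2]` irreducible some odd `m` satisfies `m·Λ_f ⊆ Λ_{h₂}`. Nothing is asserted about E-es-22 itself.
[folklore] -/
theorem multiShiftClassGenerationTwo_iff_oldformLattice :
    MultiShiftClassGenerationTwo ↔
      ∀ (W : WeierstrassCurve ℚ) [W.IsElliptic] {N : ℕ} [NeZero N] (f : CuspForm (Gamma0 N) 2),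
        IsNewformOf W f → 2 ^ 2 ∣ N → W.HasIrreducibleModPGaloisRep 2 →
        ∃ m : ℕ, ¬ 2 ∣ m ∧ ∀ z ∈ periodLattice f,
          (m : ℂ) * z ∈ periodLattice (∑ T ∈ (insert 8 (N.primeFactors.filter fun q => ¬ q ^ 2 ∣ N)).powerset,
            (-1 : ℂ) ^ T.card • degeneracyMap0 N (8 * N ^ 2) (∏ t ∈ T, t - 1 + 1) 2 f) := by
  rw [multiShiftClassGenerationTwo_iff_zero]
  constructor
  · intro H W _ N _ f hf h4 hirr
    obtain ⟨m, hm, hgen⟩ := H W f hf h4 hirr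
    refine ⟨m, hm, fun z hz => ?_⟩
    have h := hgen z hz
    simp only [primeClass] at h
    rwa [multiShiftSpan_admissible_eq_periodLattice_oldform f h4 0] at h
  · intro H W _ N _ f hf h4 hirr
    obtain ⟨m, hm, hgen⟩ := H W f hf h4 hirr
    refine ⟨m, hm, fun z hz => ?_⟩
    have h := hgen z hz
    simp only [primeClass]
    rwa [← multiShiftSpan_admissible_eq_periodLattice_oldform f h4 0] at h

end MultiOldform

end Summit.BirchSwinnertonDyer.BirchSwinnertonDyer.Theorems.ManinLocalTwoThree

end
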